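import Mathlib
import HarnessLib

/-!
# The entropy/gain bookkeeping of the container bound
(crux `DiffuseBackwardInfluence`, stmt-AtomisticToContinuum-12950, line `share-nondegeneracy-one-flight`; support file of
the lead's stub `stub_stickLD`, registered sub-goal `eventually_container_bound_le`)

The container bound (`…Containers.lean`, `…ContainersOn.lean`) controls the probability that `k` i.i.d. samples are
pairwise non-adjacent by `∑_{t ≤ f} (k choose t) ρ₀^{k-t}`: the entropy of the fingerprints against the smallness of
the containers. This Mathlib-only file does the real analysis the stick large deviation needs:

* `sum_choose_le_exp_mul_pow` — `∑_{t ≤ f} (k choose t) ≤ e^f (k/f)^f` (`1 ≤ f ≤ k`; binomial theorem at `x = f/k`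
  and `(1 + f/k)^k ≤ e^f`), hence `sum_choose_mul_pow_le`: `∑_{t ≤ f} (k choose t) ρ^{k-t} ≤ e^f (k/f)^f ρ^{k-f}`;
* `tendsto_entropyTerm` — `β + β log(1/β) → 0` as `β → 0⁺`;
* `eventually_container_bound_le` (REGISTERED) — if `f_N/(N+1) → 0`, `f_N ≥ 1`, `ρ_N ∈ (0,1]` and `log(1/ρ_N) → ∞`
  then for every `η > 0` and every rate `c`, eventually in `N`, uniformly in `η(N+1) ≤ k ≤ N+1`:
  `e^{f_N} (k/f_N)^{f_N} ρ_N^{k-f_N} ≤ e^{-c(N+1)}` — the super-exponential gain `(k - f) log(1/ρ)` beats the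
  fingerprint entropy `f(1 + log(k/f)) = (N+1)·o(1)`.
-/

namespace Summit.AtomisticToContinuum.HydrodynamicLimit.Theorems.DiffuseBackwardInfluenceShare

namespace Containers

open scoped BigOperators Topology
open Filter Set

noncomputable section

/-- **Binomial entropy of small fingerprints**: `∑_{t ≤ f} (k choose t) ≤ e^f (k/f)^f` for `1 ≤ f ≤ k`
(from `(1 + f/k)^k ≤ e^f` and the binomial theorem). [folklore] -/
theorem sum_choose_le_exp_mul_pow (k f : ℕ) (hf : 1 ≤ f) (hfk : f ≤ k) :
    (∑ t ∈ Finset.range (f + 1), (k.choose t : ℝ)) ≤ Real.exp f * ((k : ℝ) / f) ^ f := by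
  have hk : (0 : ℝ) < k := by exact_mod_cast (lt_of_lt_of_le (Nat.lt_of_lt_of_le Nat.zero_lt_one hf) hfk)
  have hfpos : (0 : ℝ) < f := by exact_mod_cast (Nat.lt_of_lt_of_le Nat.zero_lt_one hf)
  set x : ℝ := (f : ℝ) / k with hx
  have hx0 : 0 < x := div_pos hfpos hk
  have hx1 : x ≤ 1 := by rw [hx, div_le_one hk]; exact_mod_cast hfk
  -- binomial theorem
  have hbinom : (∑ t ∈ Finset.range (k + 1), (k.choose t : ℝ) * x ^ t) = (x + 1) ^ k := by
    rw [add_pow]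
    refine Finset.sum_congr rfl fun t _ => ?_
    rw [one_pow, mul_one, mul_comm]
  -- truncate and compare powers of x
  have h1 : x ^ f * ∑ t ∈ Finset.range (f + 1), (k.choose t : ℝ) ≤
      ∑ t ∈ Finset.range (f + 1), (k.choose t : ℝ) * x ^ t := by
    rw [Finset.mul_sum]
    refine Finset.sum_le_sum fun t ht => ?_
    have htf : t ≤ f := Nat.lt_succ_iff.1 (Finset.mem_range.1 ht)
    rw [mul_comm]
    exact mul_le_mul_of_nonneg_left (pow_le_pow_of_le_one hx0.le hx1 htf) (Nat.cast_nonneg _)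
  have h2 : (∑ t ∈ Finset.range (f + 1), (k.choose t : ℝ) * x ^ t) ≤
      ∑ t ∈ Finset.range (k + 1), (k.choose t : ℝ) * x ^ t :=
    Finset.sum_le_sum_of_subset_of_nonneg (Finset.range_mono (by omega))
      fun t _ _ => mul_nonneg (Nat.cast_nonneg _) (pow_nonneg hx0.le _)
  have h3 : (x + 1) ^ k ≤ Real.exp f := by
    calc (x + 1) ^ k ≤ (Real.exp x) ^ k := by
          refine pow_le_pow_left₀ (by linarith) ?_ k
          have := Real.add_one_le_exp x
          linarith
      _ = Real.exp (k * x) := by rw [← Real.exp_nat_mul]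
      _ = Real.exp f := by rw [hx, mul_div_cancel₀ _ hk.ne']
  have hxf : 0 < x ^ f := pow_pos hx0 f
  have key : x ^ f * ∑ t ∈ Finset.range (f + 1), (k.choose t : ℝ) ≤ Real.exp f :=
    h1.trans (h2.trans (hbinom.le.trans h3))
  calc (∑ t ∈ Finset.range (f + 1), (k.choose t : ℝ))
      = (x ^ f * ∑ t ∈ Finset.range (f + 1), (k.choose t : ℝ)) / x ^ f := by
        field_simp
    _ ≤ Real.exp f / x ^ f := div_le_div_of_nonneg_right key hxf.le
    _ = Real.exp f * ((k : ℝ) / f) ^ f := by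
        rw [hx, div_pow, div_div_eq_mul_div, div_pow, mul_div_assoc]

/-- The tail-weighted binomial sum of the container bound:
`∑_{t ≤ f} (k choose t) ρ^{k-t} ≤ e^f (k/f)^f ρ^{k-f}` for `ρ ∈ [0, 1]`, `1 ≤ f ≤ k`. [folklore] -/
theorem sum_choose_mul_pow_le (k f : ℕ) (hf : 1 ≤ f) (hfk : f ≤ k) {ρ : ℝ} (hρ0 : 0 ≤ ρ) (hρ1 : ρ ≤ 1) :
    (∑ t ∈ Finset.range (f + 1), (k.choose t : ℝ) * ρ ^ (k - t)) ≤
      Real.exp f * ((k : ℝ) / f) ^ f * ρ ^ (k - f) := by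
  calc (∑ t ∈ Finset.range (f + 1), (k.choose t : ℝ) * ρ ^ (k - t))
      ≤ ∑ t ∈ Finset.range (f + 1), (k.choose t : ℝ) * ρ ^ (k - f) := by
        refine Finset.sum_le_sum fun t ht => ?_
        have htf : t ≤ f := Nat.lt_succ_iff.1 (Finset.mem_range.1 ht)
        exact mul_le_mul_of_nonneg_left (pow_le_pow_of_le_one hρ0 hρ1 (by omega)) (Nat.cast_nonneg _)
    _ = (∑ t ∈ Finset.range (f + 1), (k.choose t : ℝ)) * ρ ^ (k - f) := by rw [Finset.sum_mul]
    _ ≤ Real.exp f * ((k : ℝ) / f) ^ f * ρ ^ (k - f) :=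
        mul_le_mul_of_nonneg_right (sum_choose_le_exp_mul_pow k f hf hfk) (pow_nonneg hρ0 _)

/-- `β log(1/β) + β → 0` as `β → 0⁺` (in the form used: along any sequence `β_N → 0` with `β_N > 0`). [folklore] -/
theorem tendsto_entropyTerm {β : ℕ → ℝ} (hβ : Tendsto β atTop (𝓝 0)) :
    Tendsto (fun N => β N + β N * Real.log (1 / β N)) atTop (𝓝 0) := by
  have h1 : Tendsto (fun N => β N * Real.log (β N)) atTop (𝓝 0) := by
    have hc := Real.continuous_mul_log.tendsto 0
    simp only [zero_mul] at hc
    exact hc.comp hβ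
  have h2 : Tendsto (fun N => β N + -(β N * Real.log (β N))) atTop (𝓝 (0 + -0)) := hβ.add h1.neg
  simp only [neg_zero, add_zero] at h2
  refine h2.congr fun N => ?_
  rw [one_div, Real.log_inv]
  ring

/-- **The super-exponential gain beats the fingerprint entropy.** If `f_N / (N+1) → 0`, `f_N ≥ 1`, `ρ_N ∈ (0, 1]`
and `log(1/ρ_N) → ∞`, then for every `η > 0` and every rate `c`, eventually in `N`, for all `k` with
`η(N+1) ≤ k ≤ N+1`: `e^{f_N} (k/f_N)^{f_N} ρ_N^{k - f_N} ≤ e^{-c(N+1)}`. [folklore] -/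
theorem eventually_container_bound_le : ∀ {η : ℝ}, 0 < η → ∀ {f : ℕ → ℕ} {ρ : ℕ → ℝ}, (∀ᶠ N in atTop, 1 ≤ f N) → Tendsto (fun N => (f N : ℝ) / ((N + 1 : ℕ) : ℝ)) atTop (𝓝 0) → (∀ᶠ N in atTop, 0 < ρ N ∧ ρ N ≤ 1) → Tendsto (fun N => Real.log (1 / ρ N)) atTop atTop → ∀ c : ℝ, ∀ᶠ N : ℕ in atTop, ∀ k : ℕ, η * ((N + 1 : ℕ) : ℝ) ≤ k → k ≤ N + 1 → Real.exp (f N) * ((k : ℝ) / f N) ^ (f N) * ρ N ^ (k - f N) ≤ Real.exp (-(c * ((N + 1 : ℕ) : ℝ))) := by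
  intro η hη f ρ hf1 hf0 hρ hlog c
  set β : ℕ → ℝ := fun N => (f N : ℝ) / ((N + 1 : ℕ) : ℝ) with hβdef
  have hent := tendsto_entropyTerm hf0
  have hβsmall : ∀ᶠ N in atTop, β N ≤ η / 2 := hf0.eventually (ge_mem_nhds (by positivity))
  have hent1 : ∀ᶠ N in atTop, β N + β N * Real.log (1 / β N) ≤ 1 := hent.eventually (ge_mem_nhds one_pos)
  have hL : ∀ᶠ N in atTop, (2 / η) * (|c| + 1) ≤ Real.log (1 / ρ N) := hlog.eventually_ge_atTop _
  filter_upwards [hf1, hβsmall, hent1, hL, hρ] with N hf1N hβN hentN hLN hρN k hk hkN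
  have hN : (0 : ℝ) < ((N + 1 : ℕ) : ℝ) := by positivity
  have hfpos : (0 : ℝ) < f N := by exact_mod_cast hf1N
  have hβpos : 0 < β N := div_pos hfpos hN
  have hkpos : (0 : ℝ) < k := lt_of_lt_of_le (by positivity) hk
  -- f ≤ η(N+1)/2 ≤ k/2
  have hfle : (f N : ℝ) ≤ η / 2 * ((N + 1 : ℕ) : ℝ) := by
    have : β N * ((N + 1 : ℕ) : ℝ) = f N := by rw [hβdef]; field_simp
    rw [← this]
    exact mul_le_mul_of_nonneg_right hβN hN.le
  have hfk : (f N : ℝ) ≤ k := by linarith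
  have hfk' : f N ≤ k := by exact_mod_cast hfk
  -- work with logarithms
  have hpos : 0 < Real.exp (f N) * ((k : ℝ) / f N) ^ (f N) * ρ N ^ (k - f N) := by
    have := hρN.1
    positivity
  rw [← Real.exp_log hpos, Real.exp_le_exp]
  rw [Real.log_mul (by positivity) (pow_pos hρN.1 _).ne', Real.log_mul (Real.exp_pos _).ne' (by positivity),
    Real.log_exp, Real.log_pow, Real.log_pow, Nat.cast_sub hfk']
  -- log(k/f) ≤ log((N+1)/f) = log(1/β)
  have hlogkf : Real.log ((k : ℝ) / f N) ≤ Real.log (1 / β N) := by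
    refine Real.log_le_log (div_pos hkpos hfpos) ?_
    rw [hβdef, one_div, inv_div]
    exact div_le_div_of_nonneg_right (by exact_mod_cast hkN) hfpos.le
  have hρlog : Real.log (ρ N) = -Real.log (1 / ρ N) := by rw [one_div, Real.log_inv, neg_neg]
  -- the entropy part
  have hA : (f N : ℝ) + (f N : ℝ) * Real.log ((k : ℝ) / f N) ≤ ((N + 1 : ℕ) : ℝ) * 1 := by
    have h1 : (f N : ℝ) + (f N : ℝ) * Real.log ((k : ℝ) / f N) ≤ (f N : ℝ) + (f N : ℝ) * Real.log (1 / β N) := by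
      gcongr
    have h2 : (f N : ℝ) + (f N : ℝ) * Real.log (1 / β N) = ((N + 1 : ℕ) : ℝ) * (β N + β N * Real.log (1 / β N)) := by
      rw [hβdef]; field_simp
    rw [h2] at h1
    exact h1.trans (mul_le_mul_of_nonneg_left hentN hN.le)
  -- the gain part
  have hB : ((k : ℝ) - f N) * Real.log (ρ N) ≤ -(((N + 1 : ℕ) : ℝ) * (|c| + 1)) := by
    rw [hρlog, mul_neg, neg_le_neg_iff]
    have hkf : η / 2 * ((N + 1 : ℕ) : ℝ) ≤ (k : ℝ) - f N := by linarith
    have hLpos : 0 ≤ Real.log (1 / ρ N) := le_trans (by positivity) hLN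
    calc ((N + 1 : ℕ) : ℝ) * (|c| + 1) = (η / 2 * ((N + 1 : ℕ) : ℝ)) * ((2 / η) * (|c| + 1)) := by
          field_simp
      _ ≤ ((k : ℝ) - f N) * Real.log (1 / ρ N) := mul_le_mul hkf hLN (by positivity) (by linarith)
  have hc : -(((N + 1 : ℕ) : ℝ) * (|c| + 1)) + ((N + 1 : ℕ) : ℝ) * 1 ≤ -(c * ((N + 1 : ℕ) : ℝ)) := by
    have := le_abs_self c
    nlinarith
  linarith

end

end Containers

end Summit.AtomisticToContinuum.HydrodynamicLimit.Theorems.DiffuseBackwardInfluenceShare
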